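import Mathlib
import Summits.KontsevichZagierPeriods.KontsevichZagierPeriods.Theses.SymplecticScissors
import Summits.KontsevichZagierPeriods.KontsevichZagierPeriods.Theorems.SymplecticScissorsVolumeFormSubgraphStacking
import Summits.KontsevichZagierPeriods.KontsevichZagierPeriods.Theorems.SymplecticScissorsVolumeFormStackUnionReduction
import Literature.NumberTheory.Transcendental.KZCalculusProofs
import Literature.NumberTheory.Transcendental.SemialgebraicMapsProofs

/-!
# `VolumeForm` (stmt-KontsevichZagierPeriods-3814), line `Sketch` — stub `stub_polyStackHeight`

**Polynomial stack unions have a polynomial height.** A finite pairwise disjoint union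
`r = [⋃ᵢ Sᵢ, 1]` of `k` triangular stacks `Sᵢ ⊂ ℝ³` over a rational parameter interval `(a, b)`,
whose vertex curves are `ℚ`-polynomial curves `t ↦ (Pᵢⱼ₀(t), Pᵢⱼ₁(t))` with slice determinants
`Dᵢ(t) ≠ 0` on `(a, b)`, is KZ-equivalent to the integrand-`1` planar representation on the
subgraph `{(t, σ) | a < t < b, 0 < σ < Q(t)}` of a `ℚ`-POLYNOMIAL `Q` that is non-negative on
`(a, b)`. This is a corollary of the landed stack-union reduction (`stub_stackUnionReduction`, fed
with the landed merging lemma `stub_subgraphStacking`), which produces the height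
`∑ᵢ |Dᵢ(t)| / 2`, together with a sign dichotomy: each `Dᵢ` is a polynomial without zeros on the
connected interval `(a, b)`, hence of constant sign `εᵢ ∈ {±1}` there (intermediate value
theorem), so that `∑ᵢ |Dᵢ| / 2 = ∑ᵢ (εᵢ / 2) Dᵢ =: Q` on `(a, b)` is itself a `ℚ`-polynomial.
The side conditions of the union theorem (the curves are `ℚ`-semialgebraic maps on the rational
interval and `C¹`) hold for polynomial curves.
Sources: M. Kontsevich, D. Zagier, *Periods* (2001), §1.2 rules (1)–(3); J. Cresson, J. Viu-Sos,
*On the equality of periods of Kontsevich–Zagier* (2022), §4 (polytope sector); J. Bochnak,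
M. Coste, M.-F. Roy, *Real Algebraic Geometry* (1998), §2.2; folklore.
-/

noncomputable section

open scoped BigOperators
open Set MeasureTheory
open Literature.NumberTheory.Transcendental
open Literature.ModelTheory.ExponentialFields (IsSemialgebraic isSemialgebraic_setOf_eval_lt)

namespace Summit.KontsevichZagierPeriods.SymplecticScissors.VolumeForm

/-- A `ℚ`-polynomial plane curve `t ↦ (p₀(t), p₁(t))` is a `ℚ`-semialgebraic map on a rational
interval, viewed in `ℝ¹`: the interval is cut out by two strict polynomial inequalities with
rational constants, and polynomial maps (here the one-variable polynomials `p c` pushed to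
`MvPolynomial (Fin 1) ℚ` along `X ↦ X₀`) are semialgebraic on semialgebraic sets.
[cite: BochnakCosteRoy1998, Prop. 2.2.6] -/
theorem polyHt_isSemialgebraicMapOn_curve (a b : ℚ) (p : Fin 2 → Polynomial ℚ) :
    IsSemialgebraicMapOn ℚ {z : Fin 1 → ℝ | z 0 ∈ Set.Ioo (a : ℝ) b}
      (fun z c => Polynomial.aeval (z 0) (p c)) := by
  have h1 : IsSemialgebraic ℚ {z : Fin 1 → ℝ | (a : ℝ) < z 0} := by
    simpa using isSemialgebraic_setOf_eval_lt (k := ℚ) (R := ℝ)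
      (MvPolynomial.C a : MvPolynomial (Fin 1) ℚ) (MvPolynomial.X 0)
  have h2 : IsSemialgebraic ℚ {z : Fin 1 → ℝ | z 0 < (b : ℝ)} := by
    simpa using isSemialgebraic_setOf_eval_lt (k := ℚ) (R := ℝ)
      (MvPolynomial.X 0) (MvPolynomial.C b : MvPolynomial (Fin 1) ℚ)
  have hI : IsSemialgebraic ℚ {z : Fin 1 → ℝ | z 0 ∈ Set.Ioo (a : ℝ) b} := h1.inter h2
  exact (isSemialgebraicMapOn_aeval hI (fun c => Polynomial.toMvPolynomial (0 : Fin 1) (p c))).congr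
    fun z _ => funext fun c => MvPolynomial.aeval_toMvPolynomial z 0 (p c)

/-- A `ℚ`-polynomial plane curve is `C¹` (indeed smooth) on any set. [folklore] -/
theorem polyHt_contDiffOn_curve (p : Fin 2 → Polynomial ℚ) (s : Set ℝ) :
    ContDiffOn ℝ 1 (fun (t : ℝ) (c : Fin 2) => Polynomial.aeval t (p c)) s :=
  (contDiff_pi.2 fun c => (p c).contDiff_aeval 1).contDiffOn

/-- **Sign dichotomy.** A continuous nowhere-vanishing real function on an open interval has
constant sign: `|D| = ε • D` on the interval for a rational sign `ε` (`ε = 1` if `D > 0`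
everywhere, else `ε = -1`; intermediate value theorem on the connected interval). [folklore] -/
theorem polyHt_sign {D : ℝ → ℝ} {x y : ℝ} (hD : ContinuousOn D (Set.Ioo x y))
    (h0 : ∀ t ∈ Set.Ioo x y, D t ≠ 0) :
    ∃ ε : ℚ, ∀ t ∈ Set.Ioo x y, |D t| = (ε : ℝ) * D t := by
  by_cases hpos : ∀ t ∈ Set.Ioo x y, 0 < D t
  · exact ⟨1, fun t ht => by rw [Rat.cast_one, one_mul, abs_of_pos (hpos t ht)]⟩
  · push Not at hpos
    obtain ⟨t₁, ht₁, h₁⟩ := hpos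
    have hneg : ∀ t ∈ Set.Ioo x y, D t < 0 := by
      intro t ht
      by_contra! h
      obtain ⟨c, hc, hc0⟩ := isPreconnected_Ioo.intermediate_value ht₁ ht hD ⟨h₁, h⟩
      exact h0 c hc hc0
    refine ⟨-1, fun t ht => ?_⟩
    rw [abs_of_neg (hneg t ht)]
    push_cast
    ring

/-- **Polynomial stack unions have a polynomial height.** A finite pairwise disjoint union of `k`
triangular stacks in `ℝ³` over a rational interval `(a, b)`, with `ℚ`-polynomial vertex curves and
slice determinants `Dᵢ ≠ 0` on `(a, b)` (integrand `1`), is KZ-equivalent to an integrand-`1`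
representation on the planar subgraph `{(t, σ) | a < t < b, 0 < σ < Q(t)}` of a `ℚ`-polynomial
`Q ≥ 0` on `(a, b)`, namely `Q = ∑ᵢ (εᵢ / 2) Dᵢ` with `εᵢ` the constant sign of `Dᵢ` on `(a, b)`:
the landed union reduction `stub_stackUnionReduction stub_subgraphStacking` gives the height
`∑ᵢ |Dᵢ| / 2`, and `|Dᵢ| = εᵢ Dᵢ` on the connected interval by the intermediate value theorem.
[cite: KontsevichZagier2001, §1.2 rules (1)–(3)] -/
theorem stub_polyStackHeight : ∀ (k : ℕ) (a b : ℚ) (P : Fin k → Fin 3 → Fin 2 → Polynomial ℚ) (r : KZ.IntegralRep 3),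
    a < b →
    (∀ i, ∀ t ∈ Set.Ioo (a : ℝ) b,
        (Polynomial.aeval t (P i 1 0) - Polynomial.aeval t (P i 0 0)) *
          (Polynomial.aeval t (P i 2 1) - Polynomial.aeval t (P i 0 1)) -
        (Polynomial.aeval t (P i 1 1) - Polynomial.aeval t (P i 0 1)) *
          (Polynomial.aeval t (P i 2 0) - Polynomial.aeval t (P i 0 0)) ≠ 0) →
    (∀ i i', i ≠ i' → Disjoint
      {p : Fin 3 → ℝ | p 0 ∈ Set.Ioo (a : ℝ) b ∧ ∃ l m : ℝ, 0 < l ∧ 0 < m ∧ l + m < 1 ∧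
          p 1 = Polynomial.aeval (p 0) (P i 0 0) + l * (Polynomial.aeval (p 0) (P i 1 0) - Polynomial.aeval (p 0) (P i 0 0)) +
            m * (Polynomial.aeval (p 0) (P i 2 0) - Polynomial.aeval (p 0) (P i 0 0)) ∧
          p 2 = Polynomial.aeval (p 0) (P i 0 1) + l * (Polynomial.aeval (p 0) (P i 1 1) - Polynomial.aeval (p 0) (P i 0 1)) +
            m * (Polynomial.aeval (p 0) (P i 2 1) - Polynomial.aeval (p 0) (P i 0 1))}
      {p : Fin 3 → ℝ | p 0 ∈ Set.Ioo (a : ℝ) b ∧ ∃ l m : ℝ, 0 < l ∧ 0 < m ∧ l + m < 1 ∧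
          p 1 = Polynomial.aeval (p 0) (P i' 0 0) + l * (Polynomial.aeval (p 0) (P i' 1 0) - Polynomial.aeval (p 0) (P i' 0 0)) +
            m * (Polynomial.aeval (p 0) (P i' 2 0) - Polynomial.aeval (p 0) (P i' 0 0)) ∧
          p 2 = Polynomial.aeval (p 0) (P i' 0 1) + l * (Polynomial.aeval (p 0) (P i' 1 1) - Polynomial.aeval (p 0) (P i' 0 1)) +
            m * (Polynomial.aeval (p 0) (P i' 2 1) - Polynomial.aeval (p 0) (P i' 0 1))}) →
    r.domain = ⋃ i, {p : Fin 3 → ℝ | p 0 ∈ Set.Ioo (a : ℝ) b ∧ ∃ l m : ℝ, 0 < l ∧ 0 < m ∧ l + m < 1 ∧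
          p 1 = Polynomial.aeval (p 0) (P i 0 0) + l * (Polynomial.aeval (p 0) (P i 1 0) - Polynomial.aeval (p 0) (P i 0 0)) +
            m * (Polynomial.aeval (p 0) (P i 2 0) - Polynomial.aeval (p 0) (P i 0 0)) ∧
          p 2 = Polynomial.aeval (p 0) (P i 0 1) + l * (Polynomial.aeval (p 0) (P i 1 1) - Polynomial.aeval (p 0) (P i 0 1)) +
            m * (Polynomial.aeval (p 0) (P i 2 1) - Polynomial.aeval (p 0) (P i 0 1))} →
    (∀ p ∈ r.domain, r.integrand p = 1) →
    ∃ (Q : Polynomial ℚ) (s : KZ.IntegralRep 2),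
      (∀ t ∈ Set.Ioo (a : ℝ) b, 0 ≤ Polynomial.aeval t Q) ∧
      s.domain = {q | q 0 ∈ Set.Ioo (a : ℝ) b ∧ 0 < q 1 ∧ q 1 < Polynomial.aeval (q 0) Q} ∧
      (∀ q ∈ s.domain, s.integrand q = 1) ∧ KZ.Equivalent r s := by
  intro k a b P r hab hdet hdisj hdom h1
  -- the slice determinants are the `ℚ`-polynomials `Dp i`
  obtain ⟨Dp, hDp⟩ : ∃ Dp : Fin k → Polynomial ℚ, Dp = fun i =>
      (P i 1 0 - P i 0 0) * (P i 2 1 - P i 0 1) - (P i 1 1 - P i 0 1) * (P i 2 0 - P i 0 0) :=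
    ⟨_, rfl⟩
  have hDe : ∀ (i) (t : ℝ), Polynomial.aeval t (Dp i) =
      (Polynomial.aeval t (P i 1 0) - Polynomial.aeval t (P i 0 0)) *
          (Polynomial.aeval t (P i 2 1) - Polynomial.aeval t (P i 0 1)) -
        (Polynomial.aeval t (P i 1 1) - Polynomial.aeval t (P i 0 1)) *
          (Polynomial.aeval t (P i 2 0) - Polynomial.aeval t (P i 0 0)) := fun i t => by
    simp only [hDp, map_sub, map_mul]
  -- each `Dp i` has a constant sign `ε i` on the connected interval `(a, b)`
  have hsign : ∀ i, ∃ ε : ℚ, ∀ t ∈ Set.Ioo (a : ℝ) b,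
      |Polynomial.aeval t (Dp i)| = (ε : ℝ) * Polynomial.aeval t (Dp i) := fun i =>
    polyHt_sign (Dp i).continuousOn_aeval fun t ht => by
      show Polynomial.aeval t (Dp i) ≠ 0
      rw [hDe]
      exact hdet i t ht
  choose ε hε using hsign
  -- the landed union reduction, for the polynomial vertex curves
  obtain ⟨s, hsd, hs1, hrs⟩ : ∃ s : KZ.IntegralRep 2,
      s.domain = {q | q 0 ∈ Set.Ioo (a : ℝ) b ∧ 0 < q 1 ∧
        q 1 < ∑ i, |(Polynomial.aeval (q 0) (P i 1 0) - Polynomial.aeval (q 0) (P i 0 0)) *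
            (Polynomial.aeval (q 0) (P i 2 1) - Polynomial.aeval (q 0) (P i 0 1)) -
          (Polynomial.aeval (q 0) (P i 1 1) - Polynomial.aeval (q 0) (P i 0 1)) *
            (Polynomial.aeval (q 0) (P i 2 0) - Polynomial.aeval (q 0) (P i 0 0))| / 2} ∧
      (∀ q ∈ s.domain, s.integrand q = 1) ∧ KZ.Equivalent r s :=
    stub_stackUnionReduction stub_subgraphStacking k (a : ℝ) (b : ℝ)
      (fun i j t c => Polynomial.aeval t (P i j c)) r (by exact_mod_cast hab)
      (fun i j => polyHt_isSemialgebraicMapOn_curve a b (P i j))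
      (fun i j => polyHt_contDiffOn_curve (P i j) _) hdet hdisj hdom h1
  -- the polynomial height `Q = ∑ (ε i / 2) • Dp i` agrees with `∑ |Dᵢ| / 2` on `(a, b)`
  have hQ : ∀ t ∈ Set.Ioo (a : ℝ) b, Polynomial.aeval t (∑ i, Polynomial.C (ε i / 2) * Dp i) =
      ∑ i, |Polynomial.aeval t (Dp i)| / 2 := by
    intro t ht
    rw [map_sum]
    refine Finset.sum_congr rfl fun i _ => ?_
    rw [map_mul, Polynomial.aeval_C, hε i t ht, eq_ratCast]
    push_cast
    ring
  refine ⟨∑ i, Polynomial.C (ε i / 2) * Dp i, s, fun t ht => ?_, ?_, hs1, hrs⟩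
  · rw [hQ t ht]
    exact Finset.sum_nonneg fun i _ => by positivity
  · rw [hsd]
    ext q
    simp only [Set.mem_setOf_eq]
    refine and_congr_right fun hq => ?_
    rw [hQ (q 0) hq]
    simp only [hDe]

end Summit.KontsevichZagierPeriods.SymplecticScissors.VolumeForm

end
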